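import Summits.SmoothPoincare4.SmoothPoincare4.Theorems.CylinderEntropyImmortalAreaToFloorWeightedMonotonicity
import Summits.SmoothPoincare4.SmoothPoincare4.Theorems.CylinderEntropyCylinderRungTwoLiminfDensity
import Literature.Geometry.Riemannian.EmbeddedSubmanifoldHausdorff
import HarnessLib

/-!
# Route `CylinderEntropy`, item `ImmortalAreaToFloor` (stmt-SmoothPoincare4-17197):
# Gaussian areas as integrals over the parametrising manifold, and the unit initial density at a
# good point (modules Γ3 / Γ4-conversion of `BLUEPRINT-17197-c2.md`)

For a closed embedded `f : M⁴ → ℝ⁶` with induced area measure `μ_g` and the backward heat kernel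
weight `G_t = exp(-‖f - p‖²/(4t))/(4πt)²`:
* `gaussianArea_range_eq_ofReal_integral` — the Colding–Minicozzi Gaussian area of the image is the
  integral over the manifold: `F_{p,t}(f(M)) = ofReal (∫_M G_t dμ_g)` (area formula for embeddings);
* `tendsto_integral_gaussian_nhdsGT_zero` — `∫_M G_t(· - f x₀) dμ_g → 1` as `t → 0⁺` (the landed
  Colding–Minicozzi 7.2 (3), `tendsto_gaussianArea_range_of_isSmoothEmbedding_six`);
* `initialDensity_ge` — the UNIT INITIAL DENSITY AT A GOOD POINT: if the Gaussian-weighted Willmore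
  energy is small at all scales below `σ₀`, `¼ ∫ G_s(· - f x₀) H² ≤ K` for `0 < s ≤ σ₀`, then
  `e^{-4σ₀} - K σ₀ ≤ ∫ G_{σ₀}(· - f x₀) dμ_g` — the landed weighted two-scale monotonicity with the
  constant weight `u ≡ 1` between `s → 0⁺` (density one) and `σ₀`.

References: W. K. Allard, Ann. of Math. 95 (1972) §6; T. H. Colding, W. P. Minicozzi II, Ann. of
Math. 175 (2012), Lemma 7.2.
-/

-- the prescribed namespace `Summit.SmoothPoincare4.SmoothPoincare4.…` repeats `SmoothPoincare4`
set_option linter.dupNamespace false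

noncomputable section

open Bundle Set Function Filter MeasureTheory Module
open scoped Manifold ContDiff Topology RealInnerProductSpace BigOperators ENNReal

namespace Summit.SmoothPoincare4.SmoothPoincare4.Cruxes.CylinderRungTwo.KillingFlux

open Literature.Geometry.Riemannian Literature.Geometry.Riemannian.EuclideanHypersurface
open Literature.Geometry.Lorentzian Literature.Geometry.Lorentzian.PseudoRiemannianMetric
open Literature.Geometry.Riemannian.SphericalCylinderConformal (gaussianNormalization_four)

variable {M : Type} [TopologicalSpace M] [ChartedSpace (EuclideanSpace ℝ (Fin 4)) M]
  [IsManifold (𝓡 4) ∞ M] [CompactSpace M] [T2Space M] [MeasurableSpace M] [BorelSpace M]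

/-- **Gaussian areas of the image are integrals over the manifold.**  For an injective spacelike
immersion `f : M⁴ → ℝ⁶` of a closed manifold, `p ∈ ℝ⁶` and `t > 0`:
`F_{p,t}(f(M)) = ofReal (∫_M exp(-‖f w - p‖²/(4t))/(4πt)² dμ_g(w))` (tree area formula
`lintegral_comp_riemannianMeasure_induced`, normalising factor `gaussianNormalization_four`).
[cite: ColdingMinicozzi2012, (0.5)] -/
theorem gaussianArea_range_eq_ofReal_integral {f : M → EuclideanSpace ℝ (Fin 6)}
    (hf : (euclideanMetric (EuclideanSpace ℝ (Fin 6))).IsSpacelikeImmersion (𝓡 4) f)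
    (hinj : Injective f) (p : EuclideanSpace ℝ (Fin 6)) {t : ℝ} (ht : 0 < t) :
    gaussianArea 4 p t (range f) =
      ENNReal.ofReal (∫ w, Real.exp (-‖f w - p‖ ^ 2 / (4 * t)) / (4 * Real.pi * t) ^ 2
        ∂riemannianMeasure ((euclideanMetric (EuclideanSpace ℝ (Fin 6))).inducedRiemannianMetric f
          contMDiff_pullbackBilin_holds hf)) := by
  set g₁ := (euclideanMetric (EuclideanSpace ℝ (Fin 6))).inducedRiemannianMetric f
    contMDiff_pullbackBilin_holds hf with hg₁
  have hπ := Real.pi_pos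
  have hfc : Continuous f := hf.contMDiff_self.continuous
  unfold gaussianArea gaussianMass
  rw [gaussianNormalization_four ht]
  have hlin := lintegral_comp_riemannianMeasure_induced hf hinj (fun x => gaussianWeight p t x)
  rw [← hlin]
  unfold gaussianWeight
  rw [← lintegral_const_mul' _ _ ENNReal.ofReal_ne_top]
  have hint : Integrable (fun w => Real.exp (-‖f w - p‖ ^ 2 / (4 * t)) / (4 * Real.pi * t) ^ 2)
      (riemannianMeasure g₁) :=
    integrable_of_continuous (h := g₁) (continuous_gaussianWeight_comp hf p t)
  rw [ofReal_integral_eq_lintegral_ofReal hint (Eventually.of_forall fun w =>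
    gaussianWeight_comp_nonneg f p w)]
  refine lintegral_congr fun w => ?_
  rw [← ENNReal.ofReal_mul (by positivity)]
  congr 1
  rw [neg_div, div_eq_mul_inv (Real.exp _), mul_comm]

/-- **Density one at every point, as an integral over the manifold**: for a smooth embedding
`f : M⁴ → ℝ⁶` of a closed manifold and `x₀ ∈ M`,
`∫_M exp(-‖f w - f x₀‖²/(4t))/(4πt)² dμ_g(w) → 1` as `t → 0⁺` (Colding–Minicozzi 7.2 (3), landed as
`tendsto_gaussianArea_range_of_isSmoothEmbedding_six`, read through
`gaussianArea_range_eq_ofReal_integral`). [cite: ColdingMinicozzi2012, Lemma 7.2] -/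
theorem tendsto_integral_gaussian_nhdsGT_zero {f : M → EuclideanSpace ℝ (Fin 6)}
    (hf : (euclideanMetric (EuclideanSpace ℝ (Fin 6))).IsSpacelikeImmersion (𝓡 4) f)
    (hemb : Manifold.IsSmoothEmbedding (𝓡 4) (𝓡 6) ∞ f) (x₀ : M) :
    Tendsto (fun t : ℝ => ∫ w, Real.exp (-‖f w - f x₀‖ ^ 2 / (4 * t)) / (4 * Real.pi * t) ^ 2
        ∂riemannianMeasure ((euclideanMetric (EuclideanSpace ℝ (Fin 6))).inducedRiemannianMetric f
          contMDiff_pullbackBilin_holds hf)) (𝓝[>] 0) (𝓝 1) := by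
  set g₁ := (euclideanMetric (EuclideanSpace ℝ (Fin 6))).inducedRiemannianMetric f
    contMDiff_pullbackBilin_holds hf with hg₁
  have hinj : Injective f := hemb.isEmbedding.injective
  have h1 := tendsto_gaussianArea_range_of_isSmoothEmbedding_six M hemb x₀
  have h2 : Tendsto (fun t : ℝ => (gaussianArea 4 (f x₀) t (range f)).toReal) (𝓝[>] 0) (𝓝 1) := by
    have := (ENNReal.tendsto_toReal ENNReal.one_ne_top).comp h1
    rw [ENNReal.toReal_one] at this
    exact this
  refine h2.congr' ?_
  filter_upwards [self_mem_nhdsWithin] with t (ht : 0 < t)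
  rw [gaussianArea_range_eq_ofReal_integral hf hinj (f x₀) ht, ENNReal.toReal_ofReal]
  exact integral_nonneg fun w => gaussianWeight_comp_nonneg f (f x₀) w

/-- **The unit initial density at a good point.**  For a closed embedded cross-section
`f : M⁴ → N` with smooth unit normal `ν` tangent to `N`, mean curvature `H`, a point `x₀ ∈ M`, a
scale `σ₀ > 0` and `K ≥ 0` with `¼ ∫ G_s(· - f x₀) H² dμ_g ≤ K` for all `0 < s ≤ σ₀`:
`e^{-4σ₀} - K σ₀ ≤ ∫ G_{σ₀}(· - f x₀) dμ_g`.
Proof: the landed `weightedTwoScaleMonotonicity` with `u ≡ 1` gives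
`e^{4s} F(s) ≤ e^{4σ₀} F(σ₀) + e^{4σ₀} K (σ₀ - s)` for `0 < s ≤ σ₀`, hence
`F(s) ≤ e^{4σ₀}(F(σ₀) + K σ₀)`, and `F(s) → 1` as `s → 0⁺`. [cite: Allard1972, §6] -/
theorem initialDensity_ge {f νf : M → EuclideanSpace ℝ (Fin 6)}
    (hf : (euclideanMetric (EuclideanSpace ℝ (Fin 6))).IsSpacelikeImmersion (𝓡 4) f)
    (hemb : Manifold.IsSmoothEmbedding (𝓡 4) (𝓡 6) ∞ f)
    (hν : ContMDiff (𝓡 4) 𝓘(ℝ, EuclideanSpace ℝ (Fin 6)) ∞ νf)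
    (hun : (euclideanMetric (EuclideanSpace ℝ (Fin 6))).IsUnitNormal (𝓡 4) f νf 1)
    (hN : ∀ x, ∑ i : Fin 5, f x (Fin.castSucc i) ^ 2 = 1)
    (hνN : ∀ x, ∑ i : Fin 5, νf x (Fin.castSucc i) * f x (Fin.castSucc i) = 0)
    (x₀ : M) {σ₀ K : ℝ} (hσ₀ : 0 < σ₀) (hK : 0 ≤ K)
    (hWill : ∀ s, 0 < s → s ≤ σ₀ →
      (1 / 4) * ∫ w, (Real.exp (-‖f w - f x₀‖ ^ 2 / (4 * s)) / (4 * Real.pi * s) ^ 2) *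
          (euclideanMetric (EuclideanSpace ℝ (Fin 6))).meanCurvature f contMDiff_pullbackBilin_holds
            hf νf w ^ 2
        ∂riemannianMeasure ((euclideanMetric (EuclideanSpace ℝ (Fin 6))).inducedRiemannianMetric f
          contMDiff_pullbackBilin_holds hf) ≤ K) :
    Real.exp (-(4 * σ₀)) - K * σ₀ ≤
      ∫ w, Real.exp (-‖f w - f x₀‖ ^ 2 / (4 * σ₀)) / (4 * Real.pi * σ₀) ^ 2
        ∂riemannianMeasure ((euclideanMetric (EuclideanSpace ℝ (Fin 6))).inducedRiemannianMetric f
          contMDiff_pullbackBilin_holds hf) := by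
  set g₁ := (euclideanMetric (EuclideanSpace ℝ (Fin 6))).inducedRiemannianMetric f
    contMDiff_pullbackBilin_holds hf with hg₁
  set Hm : M → ℝ := fun w => (euclideanMetric (EuclideanSpace ℝ (Fin 6))).meanCurvature f
    contMDiff_pullbackBilin_holds hf νf w with hHm
  set Φ : ℝ → ℝ := fun s => ∫ w, Real.exp (-‖f w - f x₀‖ ^ 2 / (4 * s)) / (4 * Real.pi * s) ^ 2
    ∂riemannianMeasure g₁ with hΦ
  have hΦ0 : ∀ s, 0 ≤ Φ s := fun s => integral_nonneg fun w => gaussianWeight_comp_nonneg f (f x₀) w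
  -- the two-scale inequality with the constant weight
  have hmono : ∀ s, 0 < s → s ≤ σ₀ →
      Real.exp (4 * s) * Φ s ≤ Real.exp (4 * σ₀) * Φ σ₀ + Real.exp (4 * σ₀) * K * (σ₀ - s) := by
    intro s hs hsσ
    have h := weightedTwoScaleMonotonicity hf hν hun hN hνN (f x₀) hs hsσ (u := fun _ => (1 : ℝ))
      contDiff_const (fun _ => zero_le_one) hK ?_
    · simpa only [one_mul] using h
    · intro s' hs'
      have hs'0 : 0 < s' := lt_of_lt_of_le hs hs'.1
      simp only [deriv_const', zero_mul, mul_zero, sub_zero, integral_zero, add_zero, one_mul]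
      exact hWill s' hs'0 (hs'.2)
  -- hence `Φ(s) ≤ e^{4σ₀}(Φ(σ₀) + K σ₀)` for `0 < s ≤ σ₀`
  have hbound : ∀ s, 0 < s → s ≤ σ₀ → Φ s ≤ Real.exp (4 * σ₀) * (Φ σ₀ + K * σ₀) := by
    intro s hs hsσ
    have h1 := hmono s hs hsσ
    have he : 1 ≤ Real.exp (4 * s) := Real.one_le_exp (by positivity)
    have h2 : Φ s ≤ Real.exp (4 * s) * Φ s := le_mul_of_one_le_left (hΦ0 s) he
    have h3 : Real.exp (4 * σ₀) * K * (σ₀ - s) ≤ Real.exp (4 * σ₀) * K * σ₀ :=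
      mul_le_mul_of_nonneg_left (by linarith) (by positivity)
    nlinarith
  -- pass to the limit `s → 0⁺`
  have hlim := tendsto_integral_gaussian_nhdsGT_zero hf hemb x₀
  have hev : ∀ᶠ s in 𝓝[>] (0 : ℝ), Φ s ≤ Real.exp (4 * σ₀) * (Φ σ₀ + K * σ₀) := by
    have hIoc : Set.Ioc (0 : ℝ) σ₀ ∈ 𝓝[>] (0 : ℝ) := Ioc_mem_nhdsGT hσ₀
    filter_upwards [hIoc] with s hs
    exact hbound s hs.1 hs.2
  have hone : (1 : ℝ) ≤ Real.exp (4 * σ₀) * (Φ σ₀ + K * σ₀) := le_of_tendsto hlim hev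
  -- divide by `e^{4σ₀}`
  have hexp : 0 < Real.exp (4 * σ₀) := Real.exp_pos _
  have hinv : Real.exp (-(4 * σ₀)) = (Real.exp (4 * σ₀))⁻¹ := Real.exp_neg _
  rw [hinv, sub_le_iff_le_add, inv_le_iff_one_le_mul₀ hexp]
  linarith

end Summit.SmoothPoincare4.SmoothPoincare4.Cruxes.CylinderRungTwo.KillingFlux

end
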